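import Summits.ResolutionOfSingularities.ResolutionOfSingularities.Theorems.MarkedTransferCampaignW13CanonicalFeedsProof
import Mathlib.RingTheory.ReesAlgebra
import HarnessLib

/-!
# [OURS · L1 W1.3] A positive certificate shape for the open content Prop `CampaignW13RFlatCanonicalPos`: integrality over the
# Rees algebra of an ideal of `℘(Ě,1)` (e.g. the gradient ideal of the head) forces `RFlatTailPow` (seat res-L1-s13-pv-1)

LADDER-RESOLUTION rung L (rescue), cell `res-hironaka`, RESCUE-SEED slot W1.3 (reading R-flat), rung 1 content Prop
`Campaign.CampaignW13RFlatCanonicalPos` (res-L1-type-o2 p483384; OPEN — census kit j263239/j263697/j264545: 0 counterexamples among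
12 255 sparse heads; dense passes j264900 / j265134 running at filing time). This file lands the KERNEL SHAPE in which the census's
positive integral-closure certificates («`(T·X)^n ∈` Diff-algebra», «`f^n ∈ J·(J+(f))^{n-1}`») can be replayed: if `c·X` is integral
over the REES ALGEBRA `O[I·X]` (Mathlib `reesAlgebra I`) of ANY ideal `I ⊆ ℘(Ě,1)` — for instance `I = Diff^{(j)}(J)·O`, `j < b`, or for
a hypersurface head the gradient ideal `(∂_i g)_i` — then `c ∈ ℘(Ě,1)` (`mem_pAlgPiece_one_of_isIntegral_reesAlgebra`), because
`O[I·X] ⊆ ℘(Ě)` and `℘(Ě)` is integrally closed in `O[X]` (F7′ row 4, `CampaignW13PTildeFlatIntClosed_holds`, p483887). Consequence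
for chain data: `rFlatTailPow_of_isIntegral_reesAlgebra`.

THE `p = 2`, `e = 1` REDUCTION (informal remark, this seat; NOT formalised here). For `K` perfect of characteristic 2 and a head
`g = y² + ε(x)`, with `f := T_can = ε − (square part of ε)` and `J(f) = (∂₁f, …, ∂ₙf) = (∂₁g, …, ∂ₙg)`:
`CampaignW13RFlatCanonicalPos` at this head ⟺ `f ∈ J(f)‾` (integral closure of the gradient ideal in `K[x]`). «⟸» is this file
(with `I = J(f) ⊆ Diff^{(1)}((g))·O ⊆ ℘(Ě,1)`); «⟹»: an arc `x̃(s)` with `v(f∘x̃) < min_i v(∂_i f∘x̃)` yields the SQUARE arc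
`x(t) = x̃(t²)`, `y(t) = √(ε(x(t)))` on which `g` vanishes identically, so the arc criterion for `℘(((g),2),1)` (pattern of p481686
`not_mem_pAlgPiece_one_of_arc`) fails for `f`. In characteristic 0, `f ∈ (𝔪·J(f))‾` always (chain rule along arcs); in characteristic 2
the chain rule controls only arcs of odd contact order — this is exactly the room the census passes 4/5 search.

HONEST FRAMING. Nothing here is a statement of H. Hironaka's manuscript [Hironaka2017]; OURS bookkeeping about OUR reading; `℘` bound
(algebraic, row 003; U17_4 not used). RESCUE-SEED's caveat stands (any R-flat finding leaves L-G4 / (127) open;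
`KangarooShadeIncrease.Hauser2003_kangarooShadeIncrease`). AI computation is weaker than expert review; nothing here is progress on
resolution of singularities in positive characteristic. Helper filed `--supports stmt-ResolutionOfSingularities-15522`; PROOFS ONLY.

CONTENTS (all `[folklore]`, sorry-free): `isIntegral_of_subalgebra_le`, `reesAlgebra_le_pAlgebraicRing`,
`mem_pAlgebraicRing_of_isIntegral_reesAlgebra`, `mem_pAlgPiece_one_of_isIntegral_reesAlgebra`,
`mem_pAlgPiece_one_of_isIntegral_reesAlgebra_diffIdeal`, `rFlatTailPow_of_isIntegral_reesAlgebra`.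
-/

noncomputable section

set_option linter.dupNamespace false -- mandated namespace of this single-conjunct summit

namespace Summit.ResolutionOfSingularities.ResolutionOfSingularities.Theorems.Campaign.W13

open Polynomial
open Literature.AlgebraicGeometry.Resolution
open Literature.AlgebraicGeometry.Hironaka2017
open Literature.AlgebraicGeometry.Hironaka2017.S04CharAlgebra
open Literature.AlgebraicGeometry.Hironaka2017.S09LLUED (LLChainData)

universe u

/-- Integrality is monotone in the base subalgebra: `S ≤ T ⊆ A` and `x` integral over `S` ⇒ `x` integral over `T`. [folklore] -/
theorem isIntegral_of_subalgebra_le {R A : Type*} [CommRing R] [CommRing A] [Algebra R A] {S T : Subalgebra R A}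
    (h : S ≤ T) {x : A} (hx : IsIntegral S x) : IsIntegral T x := by
  obtain ⟨f, hf, hfx⟩ := hx
  refine ⟨f.map (Subalgebra.inclusion h).toRingHom, hf.map _, ?_⟩
  rw [eval₂_map]
  exact hfx

variable (K : Type u) [CommRing K] {O : Type u} [CommRing O] [Algebra K O]

/-- The Rees algebra `O[I·X]` of an ideal `I ⊆ ℘(Ě,1)` lies in the bound characteristic algebra `℘(Ě) ⊆ O[X]`. [folklore] -/
theorem reesAlgebra_le_pAlgebraicRing (J : Ideal O) (b : ℕ) {I : Ideal O} (hI : I ≤ Campaign.pAlgPiece K J b 1) :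
    reesAlgebra I ≤ pAlgebraicRing K O J b := by
  rw [← adjoin_monomial_eq_reesAlgebra]
  refine Algebra.adjoin_le ?_
  rintro _ ⟨c, hc, rfl⟩
  exact (mem_pAlgPiece_iff K J b 1 c).mp (hI hc)

/-- An element of `O[X]` integral over the Rees algebra of an ideal `I ⊆ ℘(Ě,1)` lies in `℘(Ě)` (the latter is integrally closed in
`O[X]`, F7′ row 4). [folklore] -/
theorem mem_pAlgebraicRing_of_isIntegral_reesAlgebra (J : Ideal O) (b : ℕ) {I : Ideal O}
    (hI : I ≤ Campaign.pAlgPiece K J b 1) {x : O[X]} (hx : IsIntegral (reesAlgebra I) x) :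
    x ∈ pAlgebraicRing K O J b :=
  CampaignW13PTildeFlatIntClosed_holds K J b x (isIntegral_of_subalgebra_le (reesAlgebra_le_pAlgebraicRing K J b hI) hx)

/-- **Certificate shape.** If `c·X` is integral over `O[I·X]` for an ideal `I ⊆ ℘(Ě,1)` — i.e. `c` is integral over the IDEAL `I`
(`c^N + a₁c^{N−1} + ⋯ + a_N = 0`, `a_k ∈ I^k`) — then `c ∈ ℘(Ě,1)`. [folklore] -/
theorem mem_pAlgPiece_one_of_isIntegral_reesAlgebra (J : Ideal O) (b : ℕ) {I : Ideal O}
    (hI : I ≤ Campaign.pAlgPiece K J b 1) {c : O} (hc : IsIntegral (reesAlgebra I) (monomial 1 c : O[X])) :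
    c ∈ Campaign.pAlgPiece K J b 1 :=
  (mem_pAlgPiece_iff K J b 1 c).mpr (mem_pAlgebraicRing_of_isIntegral_reesAlgebra K J b hI hc)

/-- The case `I = Diff^{(j)}(J)·O`, `j < b` (for a hypersurface head and `j = 1`: the ideal `(g, ∂_i g)_i`). [folklore] -/
theorem mem_pAlgPiece_one_of_isIntegral_reesAlgebra_diffIdeal (J : Ideal O) {b j : ℕ} (hb : 0 < b) (hj : j < b) {c : O}
    (hc : IsIntegral (reesAlgebra (diffIdeal K j J)) (monomial 1 c : O[X])) : c ∈ Campaign.pAlgPiece K J b 1 :=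
  mem_pAlgPiece_one_of_isIntegral_reesAlgebra K J b (diffIdeal_le_pAlgPiece_one K J hb hj) hc

/-- **For chain data**: a tail whose `p^e`-th power is integral over the ideal `Diff^{(j)}(J)·O`, `j < b`, keeps `RFlatTailPow`
(v4) — the positive half of the `p = 2`, `e = 1` reduction of `CampaignW13RFlatCanonicalPos` to «`T_can ∈ J(T_can)‾`». [folklore] -/
theorem rFlatTailPow_of_isIntegral_reesAlgebra (p : ℕ) (J : Ideal O) {b j : ℕ} (hb : 0 < b) (hj : j < b) (d : LLChainData O)
    (hd : IsIntegral (reesAlgebra (diffIdeal K j J)) (monomial 1 (d.tail ^ (p ^ d.e)) : O[X])) :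
    Campaign.RFlatTailPow p K J b d :=
  mem_pAlgPiece_one_of_isIntegral_reesAlgebra_diffIdeal K J hb hj hd

end Summit.ResolutionOfSingularities.ResolutionOfSingularities.Theorems.Campaign.W13

end
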